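import Literature.MathematicalPhysics.StatisticalMechanics.HcpSiteGeometry

/-!
# Route HullExactificationCascade — item `ExactHcpLocalTheorem` (G): the thirteen-point hcp cluster

Helper file 1 for `stmt-AtomisticToContinuum-12093` (`ExactHcpLocalTheorem`, the `η = 0` hcp local
theorem).  Throughout, `a` is the in-layer spacing and `h` the layer spacing of
`hcpStacking a h = {barlowPos a h alternatingHagg k i j}` (`BarlowStacking.lean`); the item's box
`9/10 < a < 1`, `|h − a√(2/3)| ≤ a/100` is only used through the envelope
`64/100 a² < h² < 69/100 a²` (`box_envelope`).

Main result of this file: **the punctured `13/10 a`-ball of the origin in hcp is indexed by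
thirteen index triples** (`norm_site_lt_iff`): the site `(k, i, j)` has norm `< 13/10 a` iff
`(k, i, j)` is `(0,0,0)`, one of the six hexagon indices `(0, ±1, 0), (0, 0, ±1), (0, 1, −1),
(0, −1, 1)`, or one of the six cap indices `(±1, 0, 0), (±1, −1, 0), (±1, 0, −1)`; we write this
index set in the linear form
`(k = 0 ∧ |i| ≤ 1 ∧ |j| ≤ 1 ∧ |i + j| ≤ 1) ∨ (k = ±1 ∧ −1 ≤ i, j ≤ 0 ∧ −1 ≤ i + j)`
(spelled with one-sided inequalities, for `omega`).  All later finite geometry of the cluster is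
reduced to integer arithmetic on these indices.  Also: even-site translations and odd-site point
reflections of the stacking in index form, and "`−site ∈ hcp` forces an even layer" (the
anticuboctahedron has no antipodal cap points).
-/

noncomputable section

namespace Summit.AtomisticToContinuum.Crystallization.Theorems.ExactHcpLocal

open Literature.MathematicalPhysics.StatisticalMechanics

variable {a h : ℝ}

/-! ### The numeric envelope of the box -/

/-- **Envelope of the item's box**: `9/10 < a < 1`, `|h − a√(2/3)| ≤ a/100` give `0 < a`,
`0 < h` and `64/100 a² < h² < 69/100 a²` (`√(2/3) ∈ (0.8164, 0.8166)`). [folklore] -/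
theorem box_envelope (hbox : 9 / 10 < a ∧ a < 1 ∧ |h - a * Real.sqrt (2 / 3)| ≤ a / 100) :
    0 < a ∧ 0 < h ∧ 64 / 100 * a ^ 2 < h ^ 2 ∧ h ^ 2 < 69 / 100 * a ^ 2 := by
  obtain ⟨ha9, -, habs⟩ := hbox
  have ha : 0 < a := by linarith
  have hs1 : (8164 / 10000 : ℝ) < Real.sqrt (2 / 3) :=
    (Real.lt_sqrt (by norm_num)).2 (by norm_num)
  have hs2 : Real.sqrt (2 / 3) < 8166 / 10000 :=
    (Real.sqrt_lt' (by norm_num)).2 (by norm_num)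
  obtain ⟨hlo, hhi⟩ := abs_le.1 habs
  have hlow : 8064 / 10000 * a ≤ h := by nlinarith
  have hupp : h ≤ 8266 / 10000 * a := by nlinarith
  have hh : 0 < h := by nlinarith
  refine ⟨ha, hh, by nlinarith, by nlinarith⟩

/-! ### Norms of sites and the thirteen indices -/

/-- The hcp letters are `0` or `1`, as reals. [folklore] -/
theorem label_eq_zero_or_one (k : ℤ) :
    (haggLabel alternatingHagg k : ℝ) = 0 ∨ (haggLabel alternatingHagg k : ℝ) = 1 := by
  rcases haggLabel_alternating_eq_zero_or_one k with h0 | h0 <;> simp [h0]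

/-- `‖x‖ < r ↔ ‖x‖² < r²` for `0 < r`. [folklore] -/
theorem norm_lt_iff_sq_lt {x : EuclideanSpace ℝ (Fin 3)} {r : ℝ} (hr : 0 < r) :
    ‖x‖ < r ↔ ‖x‖ ^ 2 < r ^ 2 :=
  (pow_lt_pow_iff_left₀ (norm_nonneg _) hr.le two_ne_zero).symm

/-- In the cluster ball the layer index is `−1, 0` or `1`. [folklore] -/
theorem layer_le_one_of_norm_lt (ha : 0 < a) (hh1 : 64 / 100 * a ^ 2 < h ^ 2) {k i j : ℤ}
    (hlt : ‖barlowPos a h alternatingHagg k i j‖ ^ 2 < (13 / 10 * a) ^ 2) :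
    k = -1 ∨ k = 0 ∨ k = 1 := by
  rw [hcp_norm_sq_eq] at hlt
  have ha2 : 0 < a ^ 2 := by positivity
  have hQ : 0 ≤ (i : ℝ) ^ 2 + (i : ℝ) * j + (j : ℝ) ^ 2 +
      (haggLabel alternatingHagg k : ℝ) * ((i : ℝ) + j) + (haggLabel alternatingHagg k : ℝ) / 3 := by
    rcases label_eq_zero_or_one k with hL | hL <;> rw [hL]
    · nlinarith [sq_nonneg (2 * (i : ℝ) + j), sq_nonneg (j : ℝ)]
    · nlinarith [sq_nonneg (2 * (i : ℝ) + j + 1), sq_nonneg (3 * (j : ℝ) + 1)]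
  have hk3 : (k : ℝ) ^ 2 < 3 := by
    by_contra hk
    push Not at hk
    nlinarith [mul_nonneg ha2.le hQ]
  have hk3' : k ^ 2 < 3 := by exact_mod_cast hk3
  have hk1 : -1 ≤ k := by nlinarith
  have hk2 : k ≤ 1 := by nlinarith
  omega

/-- Hexagon layer: `i² + ij + j² < 2` iff `|i|, |j|, |i + j| ≤ 1` (the origin and the hexagon).
[folklore] -/
theorem hexagon_indices {i j : ℤ} (hq : i ^ 2 + i * j + j ^ 2 < 2) :
    -1 ≤ i ∧ i ≤ 1 ∧ -1 ≤ j ∧ j ≤ 1 ∧ -1 ≤ i + j ∧ i + j ≤ 1 := by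
  have hj1 : -1 ≤ j := by nlinarith [sq_nonneg (2 * i + j)]
  have hj2 : j ≤ 1 := by nlinarith [sq_nonneg (2 * i + j)]
  have hi1 : -1 ≤ i := by nlinarith [sq_nonneg (2 * j + i)]
  have hi2 : i ≤ 1 := by nlinarith [sq_nonneg (2 * j + i)]
  refine ⟨hi1, hi2, hj1, hj2, ?_, ?_⟩ <;> interval_cases i <;> interval_cases j <;> omega

/-- Cap layers: `i² + ij + j² + i + j < 1` iff `−1 ≤ i, j ≤ 0` and `−1 ≤ i + j` (the three sites
over the holes). [folklore] -/
theorem cap_indices {i j : ℤ} (hq : i ^ 2 + i * j + j ^ 2 + i + j < 1) :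
    -1 ≤ i ∧ i ≤ 0 ∧ -1 ≤ j ∧ j ≤ 0 ∧ -1 ≤ i + j := by
  have hj1 : -1 ≤ j := by nlinarith [sq_nonneg (2 * i + j + 1)]
  have hj2 : j ≤ 0 := by nlinarith [sq_nonneg (2 * i + j + 1)]
  have hi1 : -1 ≤ i := by nlinarith [sq_nonneg (2 * j + i + 1)]
  have hi2 : i ≤ 0 := by nlinarith [sq_nonneg (2 * j + i + 1)]
  refine ⟨hi1, hi2, hj1, hj2, ?_⟩
  interval_cases i <;> interval_cases j <;> omega

/-- Squared norms of the thirteen cluster sites: `0`, `a²` (hexagon) or `a²/3 + h²` (caps).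
[folklore] -/
theorem norm_sq_of_index {k i j : ℤ}
    (hL : (k = 0 ∧ -1 ≤ i ∧ i ≤ 1 ∧ -1 ≤ j ∧ j ≤ 1 ∧ -1 ≤ i + j ∧ i + j ≤ 1) ∨
      ((k = 1 ∨ k = -1) ∧ -1 ≤ i ∧ i ≤ 0 ∧ -1 ≤ j ∧ j ≤ 0 ∧ -1 ≤ i + j)) :
    ‖barlowPos a h alternatingHagg k i j‖ ^ 2 = 0 ∨
      ‖barlowPos a h alternatingHagg k i j‖ ^ 2 = a ^ 2 ∨
      ‖barlowPos a h alternatingHagg k i j‖ ^ 2 = a ^ 2 / 3 + h ^ 2 := by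
  rw [hcp_norm_sq_eq]
  rcases hL with ⟨rfl, hi1, hi2, hj1, hj2, hs1, hs2⟩ | ⟨hk, hi1, hi2, hj1, hj2, hs1⟩
  · have hL0 : haggLabel alternatingHagg 0 = 0 := haggLabel_zero _
    rw [hL0]
    interval_cases i <;> interval_cases j <;> first | (exfalso; omega) | (push_cast; norm_num)
  · have hL1 : (haggLabel alternatingHagg k : ℝ) = 1 := by
      rcases hk with rfl | rfl <;>
        exact_mod_cast haggLabel_alternating_of_odd (by decide)
    have hk2 : (k : ℝ) ^ 2 = 1 := by
      rcases hk with rfl | rfl <;> norm_num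
    rw [hL1, hk2]
    right; right
    interval_cases i <;> interval_cases j <;> first | (exfalso; omega) | (push_cast; ring)

/-- **The punctured `13/10 a`-ball of the origin in hcp, in indices**: site `(k,i,j)` has norm
`< 13/10 a` iff `(k,i,j)` is one of the thirteen cluster indices (the origin and the hexagon
`(0,±1,0),(0,0,±1),(0,1,−1),(0,−1,1)`: `k = 0`, `|i|, |j|, |i+j| ≤ 1`; the caps
`(±1,0,0),(±1,−1,0),(±1,0,−1)`: `k = ±1`, `−1 ≤ i, j ≤ 0`, `−1 ≤ i + j`). Uses only the
envelope `64/100 a² < h² < 69/100 a²`. [folklore] -/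
theorem norm_site_lt_iff (ha : 0 < a) (hh1 : 64 / 100 * a ^ 2 < h ^ 2)
    (hh2 : h ^ 2 < 69 / 100 * a ^ 2) (k i j : ℤ) :
    ‖barlowPos a h alternatingHagg k i j‖ < 13 / 10 * a ↔
      ((k = 0 ∧ -1 ≤ i ∧ i ≤ 1 ∧ -1 ≤ j ∧ j ≤ 1 ∧ -1 ≤ i + j ∧ i + j ≤ 1) ∨
        ((k = 1 ∨ k = -1) ∧ -1 ≤ i ∧ i ≤ 0 ∧ -1 ≤ j ∧ j ≤ 0 ∧ -1 ≤ i + j)) := by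
  have hr : (0 : ℝ) < 13 / 10 * a := by positivity
  rw [norm_lt_iff_sq_lt hr]
  have ha2 : 0 < a ^ 2 := by positivity
  constructor
  · intro hlt
    have hk := layer_le_one_of_norm_lt ha hh1 hlt
    rw [hcp_norm_sq_eq] at hlt
    rcases hk with rfl | rfl | rfl
    · have hL : haggLabel alternatingHagg (-1) = 1 := haggLabel_alternating_of_odd (by decide)
      rw [hL] at hlt
      push_cast at hlt
      have hq : (i : ℝ) ^ 2 + i * j + (j : ℝ) ^ 2 + i + j < 1 := by nlinarith
      have hq' : i ^ 2 + i * j + j ^ 2 + i + j < 1 := by exact_mod_cast hq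
      have := cap_indices hq'
      omega
    · have hL : haggLabel alternatingHagg 0 = 0 := haggLabel_zero _
      rw [hL] at hlt
      push_cast at hlt
      have hq : (i : ℝ) ^ 2 + i * j + (j : ℝ) ^ 2 < 2 := by nlinarith
      have hq' : i ^ 2 + i * j + j ^ 2 < 2 := by exact_mod_cast hq
      have := hexagon_indices hq'
      omega
    · have hL : haggLabel alternatingHagg 1 = 1 := haggLabel_alternating_of_odd (by decide)
      rw [hL] at hlt
      push_cast at hlt
      have hq : (i : ℝ) ^ 2 + i * j + (j : ℝ) ^ 2 + i + j < 1 := by nlinarith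
      have hq' : i ^ 2 + i * j + j ^ 2 + i + j < 1 := by exact_mod_cast hq
      have := cap_indices hq'
      omega
  · intro hL
    rcases norm_sq_of_index hL with h0 | h0 | h0 <;> rw [h0] <;> nlinarith

/-! ### Translations and point reflections of the stacking in indices -/

/-! The origin is the site `(0,0,0)` (`barlowPos_alternating_zero`) and even-layer sites
translate the stacking (`hcp_add_of_even`, `HcpHomogeneous.lean`). -/

/-- **Odd-layer sites are centres of symmetry**: `𝔰 k₀ i₀ j₀ − 𝔰 k i j = 𝔰 (k₀−k) (i₀−i) (j₀−j)`
for odd `k₀` (the point reflection through the midpoint of `0` and an odd site preserves hcp).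
[folklore] -/
theorem site_sub_of_odd {k₀ : ℤ} (hk₀ : Odd k₀) (i₀ j₀ k i j : ℤ) :
    barlowPos a h alternatingHagg k₀ i₀ j₀ - barlowPos a h alternatingHagg k i j =
      barlowPos a h alternatingHagg (k₀ - k) (i₀ - i) (j₀ - j) := by
  rcases Int.even_or_odd k with hk | hk
  · have h1 := haggLabel_alternating_of_odd hk₀
    have h2 := haggLabel_alternating_of_even hk
    have h3 := haggLabel_alternating_of_odd (hk₀.sub_even hk)
    ext l; fin_cases l <;> simp [h1, h2, h3] <;> ring
  · have h1 := haggLabel_alternating_of_odd hk₀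
    have h2 := haggLabel_alternating_of_odd hk
    have h3 := haggLabel_alternating_of_even (hk₀.sub_odd hk)
    ext l; fin_cases l <;> simp [h1, h2, h3] <;> ring

/-- Differences of sites from an even-layer site. [folklore] -/
theorem site_sub_of_even {k₀ : ℤ} (hk₀ : Even k₀) (i₀ j₀ k i j : ℤ) :
    barlowPos a h alternatingHagg k i j - barlowPos a h alternatingHagg k₀ i₀ j₀ =
      barlowPos a h alternatingHagg (k - k₀) (i - i₀) (j - j₀) := by
  rw [sub_eq_iff_eq_add, add_comm, hcp_add_of_even a h hk₀]
  congr 1 <;> ring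

/-- Membership in hcp is invariant under translation by an even-layer site. [folklore] -/
theorem mem_hcp_iff_sub_even {k₀ : ℤ} (hk₀ : Even k₀) (i₀ j₀ : ℤ)
    (x : EuclideanSpace ℝ (Fin 3)) :
    x ∈ hcpStacking a h ↔ x - barlowPos a h alternatingHagg k₀ i₀ j₀ ∈ hcpStacking a h := by
  constructor
  · rintro ⟨k, i, j, rfl⟩
    exact ⟨k - k₀, i - i₀, j - j₀, site_sub_of_even hk₀ i₀ j₀ k i j⟩
  · rintro ⟨k, i, j, hx⟩
    refine ⟨k₀ + k, i₀ + i, j₀ + j, ?_⟩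
    rw [← hcp_add_of_even a h hk₀, ← hx]
    abel

/-- Membership in hcp is invariant under the point reflection in an odd-layer site. [folklore] -/
theorem mem_hcp_iff_odd_sub {k₀ : ℤ} (hk₀ : Odd k₀) (i₀ j₀ : ℤ)
    (x : EuclideanSpace ℝ (Fin 3)) :
    x ∈ hcpStacking a h ↔ barlowPos a h alternatingHagg k₀ i₀ j₀ - x ∈ hcpStacking a h := by
  constructor
  · rintro ⟨k, i, j, rfl⟩
    exact ⟨k₀ - k, i₀ - i, j₀ - j, site_sub_of_odd hk₀ i₀ j₀ k i j⟩
  · rintro ⟨k, i, j, hx⟩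
    refine ⟨k₀ - k, i₀ - i, j₀ - j, ?_⟩
    rw [← site_sub_of_odd hk₀, ← hx]
    abel

/-- **No antipodal cap points**: if `−𝔰 k i j` is again a site then `k` is even (`a ≠ 0`,
`h ≠ 0`): comparing heights gives the layer `−k`, and comparing the `u₂`-coordinates gives
`3 (j + j') = −2 L(k)`, impossible for the letter `1`. [folklore] -/
theorem even_of_neg_site_mem (ha : a ≠ 0) (hh : h ≠ 0) {k i j : ℤ}
    (hmem : -barlowPos a h alternatingHagg k i j ∈ hcpStacking a h) : Even k := by
  obtain ⟨k', i', j', hk'⟩ := hmem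
  by_contra hodd
  rw [Int.not_even_iff_odd] at hodd
  have hL := haggLabel_alternating_of_odd hodd
  have e2 := congrArg (fun x : EuclideanSpace ℝ (Fin 3) => x 2) hk'
  simp only [PiLp.neg_apply, barlowPos_apply_two] at e2
  have hkk : (k' : ℝ) = -k := by
    have : ((k' : ℝ) + k) * h = 0 := by linarith
    rcases mul_eq_zero.1 this with h0 | h0
    · linarith
    · exact absurd h0 hh
  have hkk' : k' = -k := by exact_mod_cast hkk
  have hL' : haggLabel alternatingHagg k' = 1 := by
    rw [hkk']; exact haggLabel_alternating_of_odd hodd.neg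
  have e1 := congrArg (fun x : EuclideanSpace ℝ (Fin 3) => x 1) hk'
  simp only [PiLp.neg_apply, barlowPos_apply_one, hL, hL'] at e1
  have h3 : (0 : ℝ) < Real.sqrt 3 := by positivity
  have hj : ((3 * (j + j') : ℤ) : ℝ) = -2 := by
    push_cast
    have : a * Real.sqrt 3 / 2 * ((j : ℝ) + 1 / 3 + ((j' : ℝ) + 1 / 3)) = 0 := by linarith
    rcases mul_eq_zero.1 this with h0 | h0
    · rcases mul_eq_zero.1 (show a * Real.sqrt 3 = 0 by linarith) with h1 | h1
      · exact absurd h1 ha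
      · linarith
    · linarith
  have hj' : 3 * (j + j') = -2 := by exact_mod_cast hj
  omega

end Summit.AtomisticToContinuum.Crystallization.Theorems.ExactHcpLocal

end
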